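import Literature.NumberTheory.GaloisRepresentations.SerreCartanNormalizerGL2Fp
import HarnessLib

/-!
# The Cartan subgroup `𝔽_ℓ[√D]ˣ ⊂ GL₂(𝔽_ℓ)` from a cyclic inertia image of order `ℓ² - 1`

Topic `NumberTheory/EllipticCurves`; theorems only (no definitions, no named facts).  Pure
`GL₂(𝔽_p)` group theory feeding the discharge of the named fact
`Literature.NumberTheory.EllipticCurves.cmTorsion_cartanImage` (Lang, *Elliptic Functions*,
Ch. 10 §4, read on the `ℓ`-torsion of a CM elliptic curve over `ℚ`): the *supersingular* half of
the Cartan-image clause (6), in the vocabulary of `SerreCartanSubgroupsGL2Fp`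
(`Serre1972.adjoinElem y = 𝔽_p[y]`, `Serre1972.unitGroup k = kˣ`).

Let `Φ ∈ M₂(𝔽_p)`, `p` odd, be a non-scalar matrix with `Φ² = D`, `D ≠ 0` (the matrix of
`√D ∈ End(E)` on `E[p]`); then `tr Φ = 0`, `det Φ = -D`
(`trace_eq_zero_and_det_eq_of_mul_self_eq_smul_one`) and `det(a + bΦ) = a² - D b²`
(`det_smul_one_add_smul_eq_sq_sub`).  The main theorem
`forall_commute_and_exists_coe_eq_of_isCyclic` is J.-P. Serre, Invent. Math. 15 (1972), §4.5
(CM case: the image of the inertia group at a good supersingular `ℓ` is the whole non-split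
Cartan subgroup `(O/ℓ)ˣ`), in the following group-theoretic form: **a cyclic subgroup
`H ≤ GL₂(𝔽_p)` of order `p² - 1` all of whose elements commute or anti-commute with `Φ` (i.e.
`H` lies in the normaliser of the Cartan subgroup `𝔽_p[Φ]ˣ`, as the whole Galois image does by
Lang's Remark, Ch. 10 §4) consists of elements commuting with `Φ`, and contains every `a + bΦ`
with `a² - D b² ≠ 0`** — so `H = 𝔽_p[Φ]ˣ`.  Proof: a generator `h` of `H` cannot anti-commute
with `Φ`, for then `h²` is a scalar (Serre 1972, §2.2, "tout élément de `N - C` est d'ordre `2`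
modulo le centre"; the tree's `Serre1972.sq_eq_smul_one_of_conj_eq`), whence `h^{2(p-1)} = 1`
and `p² - 1 ∣ 2(p - 1)`, impossible for `p ≥ 3`; so `H ≤ 𝔽_p[Φ]ˣ`
(`Serre1972.mem_unitGroup_of_conj_eq`), and `#𝔽_p[Φ] = p²`
(`Serre1972.card_eq_sq_of_finrank_eq_two`) forces `H = 𝔽_p[Φ] ∖ {0}`.  In the application `H`
is the image of the inertia group at the place over `ℓ`, cyclic of order `ℓ² - 1` by Serre 1972,
§1.11, Prop. 12 c) (the tree's `isCyclic_and_card_inertia_map_of_dvd_frobeniusTrace`).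

## References

* [Serre1972] J.-P. Serre, *Propriétés galoisiennes des points d'ordre fini des courbes
  elliptiques*, Invent. Math. 15 (1972) 259–331: §2.1–§2.2 (Cartan subgroups and their
  normalisers), §1.11 Prop. 12, §4.5 (the CM case).
* [Lang1987] S. Lang, *Elliptic Functions*, 2nd ed., GTM 112 (1987), Ch. 10 §4 (Remark, Thm. 8).
-/

noncomputable section

open Matrix
open scoped MatrixGroups Classical

namespace Literature.NumberTheory.EllipticCurves

open Literature.NumberTheory.GaloisRepresentations
open Literature.NumberTheory.GaloisRepresentations.Serre1972
open Literature.NumberTheory.GaloisRepresentations.DeligneSerre1974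

/-! ### A non-scalar square root of a scalar -/

section Field

variable {F : Type*} [Field F]

/-- **A non-scalar `2 × 2` matrix `Φ` with `Φ² = D` has trace `0` and determinant `-D`**
(Cayley–Hamilton: `tr(Φ) Φ = (D + det Φ)·1`, and `Φ` is not a scalar). [folklore] -/
theorem trace_eq_zero_and_det_eq_of_mul_self_eq_smul_one {Φ : Matrix (Fin 2) (Fin 2) F} {D : F}
    (hΦ : Φ * Φ = D • (1 : Matrix (Fin 2) (Fin 2) F)) (hns : ∀ c : F, Φ ≠ c • 1) :
    Φ.trace = 0 ∧ Φ.det = -D := by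
  have hCH := TwoByTwo.mul_self_eq Φ
  have key : Φ.trace • Φ = (D + Φ.det) • (1 : Matrix (Fin 2) (Fin 2) F) := by
    rw [add_smul, ← hΦ, hCH, sub_add_cancel]
  have htr : Φ.trace = 0 := by
    by_contra h
    apply hns ((Φ.trace)⁻¹ * (D + Φ.det))
    calc Φ = (Φ.trace)⁻¹ • (Φ.trace • Φ) := by rw [smul_smul, inv_mul_cancel₀ h, one_smul]
      _ = ((Φ.trace)⁻¹ * (D + Φ.det)) • 1 := by rw [key, smul_smul]
  refine ⟨htr, ?_⟩
  rw [htr, zero_smul] at key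
  have h00 := congrFun (congrFun key 0) 0
  simp only [Matrix.zero_apply, Matrix.smul_apply, Matrix.one_apply_eq, smul_eq_mul, mul_one] at h00
  linear_combination -h00

/-- **The norm form**: for `Φ` non-scalar with `Φ² = D`, `det(a + bΦ) = a² - D b²`. [folklore] -/
theorem det_smul_one_add_smul_eq_sq_sub {Φ : Matrix (Fin 2) (Fin 2) F} {D : F}
    (hΦ : Φ * Φ = D • (1 : Matrix (Fin 2) (Fin 2) F)) (hns : ∀ c : F, Φ ≠ c • 1) (a b : F) :
    (a • (1 : Matrix (Fin 2) (Fin 2) F) + b • Φ).det = a ^ 2 - D * b ^ 2 := by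
  obtain ⟨htr, hdet⟩ := trace_eq_zero_and_det_eq_of_mul_self_eq_smul_one hΦ hns
  rw [TwoByTwo.det_smul_one_add_smul, htr, hdet]
  ring

/-- `a + bΦ ≠ 0` as soon as `a² - D b² ≠ 0`. [folklore] -/
theorem smul_one_add_smul_ne_zero {Φ : Matrix (Fin 2) (Fin 2) F} {D : F}
    (hΦ : Φ * Φ = D • (1 : Matrix (Fin 2) (Fin 2) F)) (hns : ∀ c : F, Φ ≠ c • 1) {a b : F}
    (hab : a ^ 2 - D * b ^ 2 ≠ 0) : a • (1 : Matrix (Fin 2) (Fin 2) F) + b • Φ ≠ 0 := by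
  intro h0
  apply hab
  rw [← det_smul_one_add_smul_eq_sq_sub hΦ hns a b, h0, det_zero]

/-- An element `g` *anti-commuting* with `Φ` (`Φ g = -g Φ`) conjugates `Φ` to `tr(Φ)·1 - Φ = -Φ`
(the form consumed by `Serre1972.sq_eq_smul_one_of_conj_eq`). [folklore] -/
theorem conj_eq_trace_smul_one_sub_of_anticommute {Φ : Matrix (Fin 2) (Fin 2) F} {D : F}
    (hΦ : Φ * Φ = D • (1 : Matrix (Fin 2) (Fin 2) F)) (hns : ∀ c : F, Φ ≠ c • 1)
    {g : GL (Fin 2) F} (hg : Φ * (g : Matrix (Fin 2) (Fin 2) F) = -((g : Matrix (Fin 2) (Fin 2) F) * Φ)) :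
    (g : Matrix (Fin 2) (Fin 2) F) * Φ * (g : Matrix (Fin 2) (Fin 2) F)⁻¹ = Φ.trace • 1 - Φ := by
  obtain ⟨htr, -⟩ := trace_eq_zero_and_det_eq_of_mul_self_eq_smul_one hΦ hns
  have hgu : IsUnit (g : Matrix (Fin 2) (Fin 2) F).det := (GL2.det_ne_zero g).isUnit
  rw [htr, zero_smul, zero_sub]
  have h1 : (g : Matrix (Fin 2) (Fin 2) F) * Φ = -(Φ * (g : Matrix (Fin 2) (Fin 2) F)) := by
    rw [hg, neg_neg]
  rw [h1, Matrix.neg_mul, Matrix.mul_nonsing_inv_cancel_right _ _ hgu]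

/-- An element `g` commuting with `Φ` conjugates `Φ` to itself. [folklore] -/
theorem conj_eq_self_of_commute' {Φ : Matrix (Fin 2) (Fin 2) F} {g : GL (Fin 2) F}
    (hg : Φ * (g : Matrix (Fin 2) (Fin 2) F) = (g : Matrix (Fin 2) (Fin 2) F) * Φ) :
    (g : Matrix (Fin 2) (Fin 2) F) * Φ * (g : Matrix (Fin 2) (Fin 2) F)⁻¹ = Φ := by
  have hgu : IsUnit (g : Matrix (Fin 2) (Fin 2) F).det := (GL2.det_ne_zero g).isUnit
  rw [← hg, Matrix.mul_nonsing_inv_cancel_right _ _ hgu]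

/-- **A non-scalar `Φ` cannot both commute and anti-commute with an invertible `g`** when
`2 ≠ 0`: that would give `2 gΦ = 0`, `gΦ = 0`, `Φ = 0`. (Used to read `χ(σ) = 1` off the
commutation of `ρ̄(σ)` with `√D`.) [folklore] -/
theorem false_of_commute_of_anticommute {Φ : Matrix (Fin 2) (Fin 2) F} (h2 : (2 : F) ≠ 0)
    (hns : ∀ c : F, Φ ≠ c • 1) {g : GL (Fin 2) F}
    (hc : Φ * (g : Matrix (Fin 2) (Fin 2) F) = (g : Matrix (Fin 2) (Fin 2) F) * Φ)
    (ha : Φ * (g : Matrix (Fin 2) (Fin 2) F) = -((g : Matrix (Fin 2) (Fin 2) F) * Φ)) : False := by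
  apply hns 0
  rw [zero_smul]
  have h0 : (2 : F) • ((g : Matrix (Fin 2) (Fin 2) F) * Φ) = 0 := by
    rw [two_smul]
    nth_rw 1 [← hc]
    rw [ha, neg_add_cancel]
  have h1 : (g : Matrix (Fin 2) (Fin 2) F) * Φ = 0 := (smul_eq_zero.mp h0).resolve_left h2
  calc Φ = ((g⁻¹ : GL (Fin 2) F) : Matrix (Fin 2) (Fin 2) F) * ((g : Matrix (Fin 2) (Fin 2) F) * Φ) := by
        rw [Units.inv_mul_cancel_left]
    _ = 0 := by rw [h1, Matrix.mul_zero]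

end Field

/-! ### The supersingular case: a cyclic subgroup of order `p² - 1` of the normaliser -/

section Prime

variable {p : ℕ} [Fact p.Prime]

/-- **The Cartan subgroup from a cyclic subgroup of order `p² - 1` of its normaliser** (Serre
1972, §4.5 with §2.2 and §1.11 Prop. 12 c), group-theoretic content).  Let `p` be an odd prime,
`Φ ∈ M₂(𝔽_p)` non-scalar with `Φ² = D ≠ 0`, and `H ≤ GL₂(𝔽_p)` a cyclic subgroup of order
`p² - 1` every element of which commutes or anti-commutes with `Φ`.  Then every element of `H`
commutes with `Φ`, and every `a + bΦ` with `a² - D b² ≠ 0` lies in `H` (so `H = 𝔽_p[Φ]ˣ` is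
the Cartan subgroup defined by `Φ`): a generator `h` of `H` anti-commuting with `Φ` would have
scalar square (§2.2), so `h^{2(p-1)} = 1` and `p² - 1 ∣ 2(p - 1)`, absurd; hence
`H ≤ 𝔽_p[Φ]ˣ ⊆ 𝔽_p[Φ] ∖ {0}`, a set with `p² - 1` elements.
[cite: Serre1972, §4.5 and §2.2] -/
theorem forall_commute_and_exists_coe_eq_of_isCyclic (hp2 : p ≠ 2)
    {Φ : Matrix (Fin 2) (Fin 2) (ZMod p)} {D : ZMod p}
    (hΦ : Φ * Φ = D • (1 : Matrix (Fin 2) (Fin 2) (ZMod p))) (hD : D ≠ 0)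
    (hns : ∀ c : ZMod p, Φ ≠ c • 1)
    (H : Subgroup (GL (Fin 2) (ZMod p))) [IsCyclic H] (hcard : Nat.card H = p ^ 2 - 1)
    (hN : ∀ g ∈ H, Φ * (g : Matrix (Fin 2) (Fin 2) (ZMod p)) = (g : Matrix (Fin 2) (Fin 2) (ZMod p)) * Φ ∨
      Φ * (g : Matrix (Fin 2) (Fin 2) (ZMod p)) = -((g : Matrix (Fin 2) (Fin 2) (ZMod p)) * Φ)) :
    (∀ g ∈ H, Φ * (g : Matrix (Fin 2) (Fin 2) (ZMod p)) = (g : Matrix (Fin 2) (Fin 2) (ZMod p)) * Φ) ∧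
      ∀ a b : ZMod p, a ^ 2 - D * b ^ 2 ≠ 0 →
        ∃ g ∈ H, (g : Matrix (Fin 2) (Fin 2) (ZMod p)) = a • 1 + b • Φ := by
  have hp : p.Prime := Fact.out
  have hp3 : 3 ≤ p := by
    rcases hp.eq_two_or_odd' with h | h
    · exact absurd h hp2
    · have := hp.two_le; omega
  obtain ⟨htr, hdet⟩ := trace_eq_zero_and_det_eq_of_mul_self_eq_smul_one hΦ hns
  have hdisc : Φ.trace ^ 2 - 4 * Φ.det ≠ 0 := by
    rw [htr, hdet]
    have h2 : (2 : ZMod p) ≠ 0 := two_ne_zero_of_ne_two hp2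
    have : (0 : ZMod p) ^ 2 - 4 * -D = 2 * 2 * D := by ring
    rw [this]
    exact mul_ne_zero (mul_ne_zero h2 h2) hD
  -- a generator `h` of `H`, of order `p² - 1`
  obtain ⟨h, hh⟩ := IsCyclic.exists_generator (α := H)
  have horder : orderOf (h : GL (Fin 2) (ZMod p)) = p ^ 2 - 1 := by
    rw [Subgroup.orderOf_coe, orderOf_eq_card_of_forall_mem_zpowers hh, hcard]
  -- `h` commutes with `Φ`
  have hcomm : Φ * ((h : GL (Fin 2) (ZMod p)) : Matrix (Fin 2) (Fin 2) (ZMod p)) =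
      ((h : GL (Fin 2) (ZMod p)) : Matrix (Fin 2) (Fin 2) (ZMod p)) * Φ := by
    rcases hN h h.2 with hc | hc
    · exact hc
    · exfalso
      obtain ⟨c, hc2⟩ := sq_eq_smul_one_of_conj_eq hns hdisc
        (conj_eq_trace_smul_one_sub_of_anticommute hΦ hns hc)
      have hc0 : c ≠ 0 := by
        intro h0
        rw [h0, zero_smul] at hc2
        exact GL2.det_ne_zero ((h : GL (Fin 2) (ZMod p)) ^ 2) (by rw [hc2, det_zero])
      have hpow : ((h : GL (Fin 2) (ZMod p)) ^ 2) ^ (p - 1) = 1 := by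
        apply Units.ext
        rw [Units.val_pow_eq_pow_val, hc2, smul_pow, one_pow, ZMod.pow_card_sub_one_eq_one hc0,
          one_smul, Units.val_one]
      have hdvd : p ^ 2 - 1 ∣ 2 * (p - 1) := by
        rw [← horder]
        exact orderOf_dvd_of_pow_eq_one (by rw [pow_mul, hpow])
      have hle : p ^ 2 - 1 ≤ 2 * (p - 1) := Nat.le_of_dvd (by omega) hdvd
      have h3p : 3 * p ≤ p ^ 2 := by nlinarith
      set N := p ^ 2 with hN
      omega
  -- hence `H ≤ 𝔽_p[Φ]ˣ`
  have hU : (h : GL (Fin 2) (ZMod p)) ∈ unitGroup (adjoinElem Φ) :=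
    mem_unitGroup_of_conj_eq (self_mem_adjoinElem Φ) hns (conj_eq_self_of_commute' hcomm)
  have HleU : H ≤ unitGroup (adjoinElem Φ) := by
    intro g hg
    obtain ⟨k, hk⟩ := Subgroup.mem_zpowers_iff.mp (hh ⟨g, hg⟩)
    have hgk : (g : GL (Fin 2) (ZMod p)) = (h : GL (Fin 2) (ZMod p)) ^ k := by
      rw [← Subgroup.coe_zpow, hk]
    rw [hgk]
    exact Subgroup.zpow_mem _ hU k
  refine ⟨fun g hg ↦ (mul_comm_of_mem_adjoinElem (self_mem_adjoinElem Φ) (HleU hg)), ?_⟩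
  -- counting: `H` exhausts `𝔽_p[Φ] ∖ {0}`
  intro a b hab
  set T : Finset (Matrix (Fin 2) (Fin 2) (ZMod p)) :=
    ((adjoinElem Φ : Subalgebra (ZMod p) (Matrix (Fin 2) (Fin 2) (ZMod p))) :
      Set (Matrix (Fin 2) (Fin 2) (ZMod p))).toFinset with hT
  have hTcard : T.card = p ^ 2 := by
    rw [hT, Set.toFinset_card, ← Nat.card_eq_fintype_card]
    exact card_eq_sq_of_finrank_eq_two (finrank_adjoinElem hns)
  set f : H → Matrix (Fin 2) (Fin 2) (ZMod p) :=
    fun g ↦ ((g : GL (Fin 2) (ZMod p)) : Matrix (Fin 2) (Fin 2) (ZMod p)) with hf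
  have hfinj : Function.Injective f := fun x y hxy ↦ Subtype.ext (Units.ext hxy)
  set S : Finset (Matrix (Fin 2) (Fin 2) (ZMod p)) := (Finset.univ : Finset H).image f with hS
  have hScard : S.card = p ^ 2 - 1 := by
    rw [hS, Finset.card_image_of_injective _ hfinj, Finset.card_univ, ← Nat.card_eq_fintype_card,
      hcard]
  have h0T : (0 : Matrix (Fin 2) (Fin 2) (ZMod p)) ∈ T := by
    rw [hT, Set.mem_toFinset]
    exact (adjoinElem Φ).zero_mem
  have hSsub : S ⊆ T.erase 0 := by
    intro m hm
    obtain ⟨g, -, rfl⟩ := Finset.mem_image.mp hm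
    rw [Finset.mem_erase]
    refine ⟨fun h0 ↦ GL2.det_ne_zero (g : GL (Fin 2) (ZMod p)) ?_, ?_⟩
    · have h0' : ((g : GL (Fin 2) (ZMod p)) : Matrix (Fin 2) (Fin 2) (ZMod p)) = 0 := h0
      rw [h0', det_zero]
    rw [hT, Set.mem_toFinset]
    exact HleU g.2
  have hcardE : (T.erase 0).card = p ^ 2 - 1 := by
    rw [Finset.card_erase_of_mem h0T, hTcard]
  have hSeq : S = T.erase 0 :=
    Finset.eq_of_subset_of_card_le hSsub (by rw [hScard, hcardE])
  have hm : a • (1 : Matrix (Fin 2) (Fin 2) (ZMod p)) + b • Φ ∈ T.erase 0 := by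
    rw [Finset.mem_erase, hT, Set.mem_toFinset]
    exact ⟨smul_one_add_smul_ne_zero hΦ hns hab, ⟨a, b, rfl⟩⟩
  rw [← hSeq, hS] at hm
  obtain ⟨g, -, hg⟩ := Finset.mem_image.mp hm
  exact ⟨g, g.2, hg⟩

end Prime

end Literature.NumberTheory.EllipticCurves

end
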